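import Summits.QuantumFields.QCD.Theorems.PauliWegnerSeaChiralGluonicCompletionDefs
import Literature.MathematicalPhysics.QuantumFieldTheory.QCDFlavourSymmetry
import Literature.MathematicalPhysics.QuantumFieldTheory.QCDPhaseQuenchedReweighting
import Summits.QuantumFields.QCD.Theorems.PauliWegnerSeaGluonicCompletionSignDecorrelationDegenerate
import Summits.QuantumFields.QCD.Theorems.PauliWegnerSeaGluonicCompletionDetNonvanishing

/-!
# Crux `ChiralGluonicCompletion` (stmt-QuantumFields-17498), line `Sketch` — sub-goal of stub C1:
# the flavour-CHARGED sector of the lattice gap at `N_f = 2` on the mass-degenerate line (statement probe)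
-/

noncomputable section

namespace Summit.QuantumFields.QCD.Theorems.StronglyChiralSubsequence

open MeasureTheory Filter Topology
open Literature.MathematicalPhysics.QuantumFieldTheory Literature.MathematicalPhysics.QuantumLattice
  Literature.Probability.LatticeModels

/-! ### Torus-level glue: reweighting on the degenerate locus, a non-singular configuration from
clause (iii), and the flavour selection rule for a charged observable -/

/-- **Honest = phase-quenched on the isospin-symmetric two-flavour locus.**  For `N_f = 2` with
`m_u = m_d` and one configuration of non-zero Wilson determinant, the honest (signed) functional
`qcdTorusExpect` is the phase-quenched expectation of the Berezin ratio
`⟨X⟩_F = ∫dψ̄dψ X e^{−ψ̄Dψ} / ∫dψ̄dψ e^{−ψ̄Dψ}`: `det D ≠ 0` a.e. (`stub_detNonvanishing`) gives the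
reweighting identity `⟨X⟩ = ⟨W⟨X⟩_F⟩₊/⟨W⟩₊`, and `det D = (det D_W)² ≥ 0` makes the sign `W` invisible
under the weight `|det D|`, so `⟨W⟨X⟩_F⟩₊ = ⟨⟨X⟩_F⟩₊` and `⟨W⟩₊ = ⟨1⟩₊ = 1`. [folklore] -/
theorem qcdTorusExpect_two_degenerate {S : ℕ} [NeZero S] (β : ℝ) (mq : Fin 2 → ℝ)
    (h : mq 0 = mq 1) (hex : ∃ U₀ : GaugeConfig 4 S SU3, (diracMatrix U₀ mq).det ≠ 0)
    (X : GaugeConfig 4 S SU3 → FermiAlg 2 S) :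
    qcdTorusExpect β S mq X =
      qcdPhaseQuenchedExpect β S mq
        (fun U => fermiIntegral (X U * fermiBoltzmann U mq) / fermiIntegral (fermiBoltzmann U mq)) := by
  have hae := FiniteSignBudgetAtTheSchemeVolume.stub_detNonvanishing 2 S β mq hex
  rw [qcdTorusExpect_eq_phaseQuenched β mq X hae]
  have h1 : qcdPhaseQuenchedExpect β S mq (fun U => qcdDetPhase U mq *
      (fermiIntegral (X U * fermiBoltzmann U mq) / fermiIntegral (fermiBoltzmann U mq))) =
      qcdPhaseQuenchedExpect β S mq
        (fun U => fermiIntegral (X U * fermiBoltzmann U mq) / fermiIntegral (fermiBoltzmann U mq)) := by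
    simp only [qcdPhaseQuenchedExpect_def,
      FiniteSignBudgetAtTheSchemeVolume.smul_qcdDetPhase_mul_two_degenerate _ mq h]
  have h2 : qcdPhaseQuenchedExpect β S mq (fun U => qcdDetPhase U mq) = 1 := by
    have h3 : qcdPhaseQuenchedExpect β S mq (fun U => qcdDetPhase U mq) =
        qcdPhaseQuenchedExpect β S mq (fun _ => (1 : ℂ)) := by
      simp only [qcdPhaseQuenchedExpect_def]
      congr 1
      refine integral_congr_ae (Eventually.of_forall fun U => ?_)
      have h4 := FiniteSignBudgetAtTheSchemeVolume.smul_qcdDetPhase_mul_two_degenerate U mq h 1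
      rwa [mul_one] at h4
    rw [h3, qcdPhaseQuenchedExpect_const_of_exists β mq hex]
  rw [h1, h2, div_one]

/-- **A lower bound on a phase-quenched ratio forces a non-singular configuration.**  If
`0 < c ≤ num / ∫ |det D| dμ_W` then some configuration has `det D ≠ 0`: otherwise the denominator
is `∫ 0 = 0` and the ratio is the junk value `0 < c`. [folklore] -/
theorem exists_det_ne_zero_of_le_div {Nf S : ℕ} [NeZero S] (β : ℝ) (mq : Fin Nf → ℝ)
    {c num : ℝ} (hc : 0 < c)
    (h : c ≤ num / ∫ U : GaugeConfig 4 S SU3, ‖(diracMatrix U mq).det‖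
      ∂(wilsonMeasure (fundamentalRep (Fin 3)) β)) :
    ∃ U₀ : GaugeConfig 4 S SU3, (diracMatrix U₀ mq).det ≠ 0 := by
  by_contra hall
  have hall' : ∀ U : GaugeConfig 4 S SU3, (diracMatrix U mq).det = 0 := fun U =>
    not_not.1 fun hU => hall ⟨U, hU⟩
  have h0 : ∫ U : GaugeConfig 4 S SU3, ‖(diracMatrix U mq).det‖
      ∂(wilsonMeasure (fundamentalRep (Fin 3)) β) = 0 := by
    simp [hall']
  rw [h0, div_zero] at h
  exact absurd h (not_le.2 hc)

/-- **Flavour selection rule for a `U(1)_{f₀}`-charged observable.**  If `A` carries the non-zero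
charge `q` under the vector flavour phase of flavour `f₀` (the hypothesis of `PhaseQuenchedFlavourDecay`:
`ψ̄_{f₀} ↦ e^{−iθ}ψ̄_{f₀}`, `ψ_{f₀} ↦ e^{iθ}ψ_{f₀}` multiplies `A.F U` by `e^{iqθ}`), then `⟨A⟩ = 0` on
every torus, at every coupling, for all bare masses and every placement `v`: at `θ = π/q` the phase
is `flavourScale t` with `t_{f₀} = e^{iθ}`, `t_f = 1` otherwise, acting by `e^{iπ} = −1 ≠ 1`, and the
torus placement intertwines it with `fermiFlavourScale t`, a symmetry of the functional
(`qcdTorusExpect_eq_zero_of_fermiFlavourScale`). [folklore] -/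
theorem qcdTorusExpect_onTorus_eq_zero_of_charged {Nf R : ℕ} (A : QCDLatticeObservable Nf R)
    (hA : ∃ (f₀ : Fin Nf) (q : ℤ), q ≠ 0 ∧ ∀ (θ : ℝ) (U : LGConfig 4 (Matrix.specialUnitaryGroup (Fin 3) ℂ)), ExteriorAlgebra.map (LinearMap.pi fun w => (Sum.elim (fun i => if (boxQuarkEquiv.symm i).1 = f₀ then Complex.exp (-((θ : ℂ) * Complex.I)) else 1) (fun i => if (boxQuarkEquiv.symm i).1 = f₀ then Complex.exp ((θ : ℂ) * Complex.I) else 1) (ofLex w)) • LinearMap.proj w) (A.F U) = Complex.exp (((q : ℝ) * θ : ℝ) * Complex.I) • A.F U)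
    {S : ℕ} [NeZero S] (β : ℝ) (mq : Fin Nf → ℝ) (v : Literature.Probability.LatticeModels.Site 4) :
    qcdTorusExpect β S mq (A.onTorus S v) = 0 := by
  obtain ⟨f₀, q, hq, hch⟩ := hA
  obtain ⟨θ, hθ⟩ : ∃ θ : ℝ, (q : ℝ) * θ = Real.pi :=
    ⟨Real.pi / q, mul_div_cancel₀ _ (Int.cast_ne_zero.2 hq)⟩
  have htne : ∀ f, (fun f : Fin Nf => if f = f₀ then Complex.exp ((θ : ℂ) * Complex.I) else 1) f ≠ 0 := by
    intro f
    dsimp only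
    split_ifs
    · exact Complex.exp_ne_zero _
    · exact one_ne_zero
  have hc : Complex.exp (((q : ℝ) * θ : ℝ) * Complex.I) ≠ 1 := by
    rw [hθ, Complex.exp_pi_mul_I]; norm_num
  have key : QCDLatticeObservable.flavourScale (R := R)
      (fun f : Fin Nf => if f = f₀ then Complex.exp ((θ : ℂ) * Complex.I) else 1) =
      ExteriorAlgebra.map (LinearMap.pi fun w => (Sum.elim
        (fun i => if (boxQuarkEquiv.symm i).1 = f₀ then Complex.exp (-((θ : ℂ) * Complex.I)) else 1)
        (fun i => if (boxQuarkEquiv.symm i).1 = f₀ then Complex.exp ((θ : ℂ) * Complex.I) else 1)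
        (ofLex w)) • LinearMap.proj w) := by
    rw [QCDLatticeObservable.flavourScale_eq]
    congr 1
    refine LinearMap.ext fun x => funext fun w => ?_
    simp only [LinearMap.pi_apply, LinearMap.smul_apply, smul_eq_mul]
    congr 1
    induction w using lex_sum_ind with
    | hl a =>
      simp only [QCDLatticeObservable.flavourWeight_inl, ofLex_toLex, Sum.elim_inl]
      split_ifs
      · exact (Complex.exp_neg _).symm
      · exact inv_one
    | hr b =>
      simp only [QCDLatticeObservable.flavourWeight_inr, ofLex_toLex, Sum.elim_inr]
  have hfix : ∀ U', QCDLatticeObservable.flavourScale (R := R)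
      (fun f : Fin Nf => if f = f₀ then Complex.exp ((θ : ℂ) * Complex.I) else 1) (A.F U') =
      Complex.exp (((q : ℝ) * θ : ℝ) * Complex.I) • A.F U' := fun U' => by
    rw [key]; exact hch θ U'
  refine qcdTorusExpect_eq_zero_of_fermiFlavourScale htne hc β mq _ fun U => ?_
  rw [fermiFlavourScale_onTorus, hfix, map_smul, QCDLatticeObservable.onTorus]

/-! ### The registered sub-goal -/

/-- **C1, charged sector, `N_f = 2`, degenerate masses.**  For a regularisation carrying the crux's package and a
degenerate positive tuple `(t,t)`, every pair `(A, B)` with `A` of non-zero `U(1)_{f₀}` flavour charge has the uniform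
lattice-gap bound of `HasLatticeMassGap` at the PQFD rate: `det D = (det D_W)² ≥ 0` makes the honest functional the
phase-quenched one (a.e. `det ≠ 0` from clause (iii)), `⟨A⟩ = 0` by the flavour selection rule, and PQFD bounds `⟨A B⟩₊`. -/
theorem stub_chargedGap_two_degenerate : ∀ reg : QCDRegularisation 2, Hyp 2 reg → ∀ t : ℝ, 0 < t →
    ∃ Δ > 0, ∀ (R R' : ℕ) (A : QCDLatticeObservable 2 R) (B : QCDLatticeObservable 2 R'),
      (∃ (f₀ : Fin 2) (q : ℤ), q ≠ 0 ∧ ∀ (θ : ℝ) (U : LGConfig 4 (Matrix.specialUnitaryGroup (Fin 3) ℂ)), ExteriorAlgebra.map (LinearMap.pi fun w => (Sum.elim (fun i => if (boxQuarkEquiv.symm i).1 = f₀ then Complex.exp (-((θ : ℂ) * Complex.I)) else 1) (fun i => if (boxQuarkEquiv.symm i).1 = f₀ then Complex.exp ((θ : ℂ) * Complex.I) else 1) (ofLex w)) • LinearMap.proj w) (A.F U) = Complex.exp (((q : ℝ) * θ : ℝ) * Complex.I) • A.F U) →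
      ∃ C : ℝ, ∀ᶠ k in atTop, ∀ S : ℕ, reg.L k ≤ S → ∀ n : ℕ, n ≤ S →
        ‖qcdLatticeConnectedCorr (reg.β k) (2 * S + 1) (fun fl => (reg.scheme (fun _ => t) 0 0).mq fl k) A B n‖ ≤
          C * Real.exp (-(Δ * (reg.a k * n))) := by
  intro reg hH t ht
  -- the per-mass package at the degenerate tuple `(t, t)`: clause (iii) and PQFD are all that is used
  obtain ⟨⟨-, -, hIII, -⟩, δ', hδ', hPQ⟩ := hH.2.2.2 (fun _ => t) (fun _ => ht)
  refine ⟨δ', hδ', fun R R' A B hA => ?_⟩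
  obtain ⟨C', hC'⟩ := hPQ R R' A B hA
  obtain ⟨s, c₀, C₁, p, -, -, hc₀, hIII'⟩ := hIII
  refine ⟨C', ?_⟩
  filter_upwards [hC', hIII'] with k hk hk3
  intro S hS n hn
  -- PQFD's bound on the phase-quenched quotient, and clause (iii) at `f = 0`, `n = 0`
  have hb := hk S hS n hn
  have hl := hk3 S hS 0 0 (Nat.zero_le _)
  -- normalise the bare masses `m_crit(k) + a_k t / Z_m(k)` of both flavours to one syntactic form `mq`
  simp only [QCDRegularisation.scheme_mq]
  beta_reduce at hb hl
  set mq : Fin 2 → ℝ := fun _ => reg.mcrit k + reg.a k * t / reg.Zm k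
  -- one configuration with `det D ≠ 0` on the torus of side `2S+1`
  have hex : ∃ U₀ : GaugeConfig 4 (2 * S + 1) SU3, (diracMatrix U₀ mq).det ≠ 0 :=
    exists_det_ne_zero_of_le_div (reg.β k) mq (mul_pos hc₀ (Real.exp_pos _)) hl
  -- the two bare masses coincide
  have hdeg : mq 0 = mq 1 := rfl
  -- `⟨A B⟩ − ⟨A⟩⟨B⟩ = ⟨A B⟩ = ⟨⟨A B⟩_F⟩₊` = PQFD's quotient
  rw [qcdLatticeConnectedCorr, qcdTorusExpect_onTorus_eq_zero_of_charged A hA, zero_mul, sub_zero,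
    qcdTorusExpect_two_degenerate (reg.β k) mq hdeg hex, qcdPhaseQuenchedExpect_eq_div_complex]
  exact hb

end Summit.QuantumFields.QCD.Theorems.StronglyChiralSubsequence

end
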